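import Summits.CriticalPhenomena.Ising3DConformalLimit.Theses.FKParityRobustness
import Summits.CriticalPhenomena.Ising3DConformalLimit.Theorems.FKParityRobustnessIndependentStrandsJoinRectTransfer
import HarnessLib

/-!
# Route `FKParityRobustness`, crux `IndependentStrandsJoin` (stmt-CriticalPhenomena-14625), line `pinch-to-tetra` r6:
# the rectangle → tetrahedron transfer READ IN THE SCALING LIMIT (registered sub-goal `stub_rectLimitDictionary`)

Lead `prover-line-stmt-CriticalPhenomena-14625-c6-0` (2026-08-17).  Theorem-only file (no definitions, no notation).

Let `(ρ, S)` be any non-degenerate pointwise scaling limit of the critical correlators `criticalCorr 3` of `ℤ³`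
(`ρ > 0` on `(0,1]`; the data of `LimitExists`), `y_A = yTetra` the regular tetrahedron
`tetra = ((−1,−1,−1),(1,1,−1),(1,−1,1),(−1,1,1))` cast to `ℝ³` and `y_R` the RP-diagonal rectangle
`rect = ((−1,−1,−1),(1,1,−1),(−1,−1,1),(1,1,1))` cast to `ℝ³` (written out literally below).  Along the meshes
`δ_l = 1/l` the lattice approximations of `y_A`, `y_R` are EXACTLY `l·tetra`, `l·rect` (`latticeApprox_inv_natCast`), so
the landed lattice statements of `…RectTransfer.lean` pass to the limit:

* `limit_S4_tetra_le_rect` : `S₄(y_A) ≤ S₄(y_R)` (from `criticalCorr_tetra_le_rect`, `ρ(1/l)⁴ ≥ 0`);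
* `limitConnectedFour_tetra_le_rect` : `U₄(S)(y_A) ≤ S₄(y_R) − 3·S₂(y_{A,0},y_{A,1})·S₂(y_{A,2},y_{A,3})`
  (from `U4crit_le_rect`; the rescaled `U₄crit`, `GG` converge to `U₄(S)(y_A)`, `S₂S₂`);
* `rectDominance_iff_limit` : RectDominance (`∃ c > 0`, eventually `⟨σσσσ⟩(l·rect) ≤ (3 − c)·GG`) is EQUIVALENT to the
  strict limit inequality `S₄(y_R) < 3·S₂S₂` (the abstract ratio/limit lemma `eventually_le_sub_mul_iff_limit_lt`,
  `S₂S₂ > 0` by non-degeneracy);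
* `independentStrandsJoin_of_limit_rect` : `S₄(y_R) < 3·S₂S₂ ⟹ IndependentStrandsJoin` (the landed dictionary
  `independentStrandsJoin_iff_limitU4_tetra_neg`);
* `Theorems.stub_rectLimitDictionary` : the registered conjunction of the four.

References: J. Fröhlich, R. Israel, E. H. Lieb, B. Simon, Comm. Math. Phys. 62 (1978) §2 [FILS1978];
M. Aizenman, Comm. Math. Phys. 86 (1982) Prop. 5.3 [AizenmanCMP1982].
-/

noncomputable section

open Filter Topology Finset
open Literature.Probability.LatticeModels
open Summit.CriticalPhenomena.Ising3DConformalLimit.Theses.FKParityRobustness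
open Summit.CriticalPhenomena.Ising3DConformalLimit.FKParityRobustnessFarMergingGivesU4
  (injective_vecCons_pair injective_toLp_intCast latticeApprox_inv_natCast)
open Summit.CriticalPhenomena.Ising3DConformalLimit.Cruxes.ParityRobustMerging.PlaquetteXorSurgery (tetra tetra_inj)

namespace Summit.CriticalPhenomena.Ising3DConformalLimit.Cruxes.IndependentStrandsJoin.PinchToTetra

/-! ### An abstract ratio/limit lemma -/

/-- **Ratio/limit lemma.**  Let `r_l > 0` (for `l ≥ 1`) be a rescaling with `r·f → A` and `r·g → B > 0`.  Then an
eventual lattice-type bound `f_l ≤ (κ − c)·g_l` with SOME `c > 0` holds iff the strict limit inequality `A < κ·B` does: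
(→) pass `r·f ≤ (κ − c)·(r·g)` to the limit, `A ≤ (κ − c)B < κB`; (←) with `c = (κB − A)/(2B) > 0` the sequence
`r·f − (κ − c)·(r·g) → A − (κ − c)B < 0` is eventually negative and `r > 0` un-rescales. [folklore] -/
theorem eventually_le_sub_mul_iff_limit_lt {r f g : ℕ → ℝ} {A B κ : ℝ} (hr : ∀ l : ℕ, 1 ≤ l → 0 < r l)
    (hf : Tendsto (fun l => r l * f l) atTop (𝓝 A)) (hg : Tendsto (fun l => r l * g l) atTop (𝓝 B))
    (hB : 0 < B) :
    (∃ c : ℝ, 0 < c ∧ ∃ l₁ : ℕ, ∀ l : ℕ, l₁ ≤ l → f l ≤ (κ - c) * g l) ↔ A < κ * B := by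
  constructor
  · rintro ⟨c, hc, l₁, hl⟩
    have hle : A ≤ (κ - c) * B := by
      refine le_of_tendsto_of_tendsto hf (hg.const_mul (κ - c)) ?_
      filter_upwards [eventually_ge_atTop l₁, eventually_ge_atTop 1] with l hl' hl1
      show r l * f l ≤ (κ - c) * (r l * g l)
      have h := mul_le_mul_of_nonneg_left (hl l hl') (hr l hl1).le
      linarith
    have hcB : 0 < c * B := mul_pos hc hB
    linarith
  · intro hlt
    set c : ℝ := (κ * B - A) / (2 * B) with hc
    have hcpos : 0 < c := div_pos (by linarith) (by positivity)
    have hneg : A - (κ - c) * B < 0 := by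
      have e : (κ - c) * B = (κ * B + A) / 2 := by
        rw [hc]
        field_simp
        ring
      rw [e]
      linarith
    have hev : ∀ᶠ l : ℕ in atTop, r l * f l - (κ - c) * (r l * g l) < 0 :=
      (hf.sub (hg.const_mul (κ - c))).eventually (gt_mem_nhds hneg)
    obtain ⟨l₁, hl₁⟩ := Filter.eventually_atTop.1 (hev.and (Filter.eventually_ge_atTop 1))
    refine ⟨c, hcpos, l₁, fun l hl => ?_⟩
    obtain ⟨hlt', hl1⟩ := hl₁ l hl
    have hrpos := hr l hl1
    by_contra hcon
    have hcon' : (κ - c) * g l < f l := lt_of_not_ge hcon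
    have h := mul_lt_mul_of_pos_left hcon' hrpos
    linarith

/-! ### The lattice data of the regular tetrahedron and of the rectangle, rescaled, converge -/

/-- The four vertices of the RP-diagonal rectangle `((−1,−1,−1),(1,1,−1),(−1,−1,1),(1,1,1))` are distinct.
[folklore] -/
theorem rect_injective :
    Function.Injective (![![-1, -1, -1], ![1, 1, -1], ![-1, -1, 1], ![1, 1, 1]] : Fin 4 → Site 3) := by
  decide

section limit

variable {ρ : ℝ → ℝ} {S : CorrFamily 3}

/-- `ρ(1/l)ⁿ > 0` for `l ≥ 1` when `ρ > 0` on `(0,1]`. [folklore] -/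
theorem rho_inv_natCast_pow_pos (hρ : ∀ δ ∈ Set.Ioc (0:ℝ) 1, 0 < ρ δ) {l : ℕ} (hl : 1 ≤ l) (n : ℕ) :
    0 < ρ ((l : ℝ)⁻¹) ^ n := by
  have hl0 : (1 : ℝ) ≤ l := by exact_mod_cast hl
  exact pow_pos (hρ _ ⟨by positivity, inv_le_one_of_one_le₀ hl0⟩) n

/-- **Convergence along integer dilations.**  For a pointwise scaling limit `(ρ, S)` of `criticalCorr 3` and an
injective lattice configuration `x`, the rescaled correlator `ρ(1/l)ⁿ·⟨∏σ_{l·xᵢ}⟩_{β_c}` converges to `S n (x ⊂ ℝ³)` as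
`l → ∞` (the lattice approximation at mesh `1/l` of the cast configuration is exactly `l·x`). [folklore] -/
theorem tendsto_rescaled_criticalCorr (hlim : HasPointwiseScalingLimit (criticalCorr 3) ρ S) {n : ℕ}
    {x : Fin n → Site 3} (hx : Function.Injective x) :
    Tendsto (fun l : ℕ => ρ ((l : ℝ)⁻¹) ^ n * criticalCorr 3 n (fun i => (l : ℤ) • x i)) atTop
      (𝓝 (S n (fun i => WithLp.toLp 2 fun k => ((x i k : ℤ) : ℝ)))) := by
  have hδ : Tendsto (fun l : ℕ => ((l : ℝ))⁻¹) atTop (𝓝[>] (0 : ℝ)) :=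
    tendsto_inv_atTop_nhdsGT_zero.comp tendsto_natCast_atTop_atTop
  have hy : (fun i => (WithLp.toLp 2 fun k => ((x i k : ℤ) : ℝ) : EuclideanSpace ℝ (Fin 3))) ∈ NonCoincident 3 n :=
    injective_toLp_intCast hx
  refine (((hlim n).tendsto_at hy).comp hδ).congr fun l => ?_
  simp only [Function.comp_apply, rescaledCorrelator_apply, latticeApprox_inv_natCast]

/-- The rescaled pair correlations of the dilated regular tetrahedron converge to the limit two-point function at
the corresponding pair of vertices of `y_A`. [folklore] -/
theorem tendsto_rescaled_pair (hlim : HasPointwiseScalingLimit (criticalCorr 3) ρ S) {a b : Fin 4} (hab : a ≠ b) :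
    Tendsto (fun l : ℕ => ρ ((l : ℝ)⁻¹) ^ 2 * criticalCorr 3 2 ![(l : ℤ) • tetra a, (l : ℤ) • tetra b]) atTop
      (𝓝 (S 2 ![yTetra a, yTetra b])) := by
  have h := tendsto_rescaled_criticalCorr hlim (injective_vecCons_pair (tetra_inj.ne hab))
  have e : (fun i => (WithLp.toLp 2 fun k => (((![tetra a, tetra b] : Fin 2 → Site 3) i k : ℤ) : ℝ) :
      EuclideanSpace ℝ (Fin 3))) = ![yTetra a, yTetra b] := by
    funext i
    fin_cases i <;> rfl
  rw [e] at h
  refine h.congr fun l => ?_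
  have e' : (fun i => (l : ℤ) • (![tetra a, tetra b] : Fin 2 → Site 3) i) = ![(l : ℤ) • tetra a, (l : ℤ) • tetra b] := by
    funext i
    fin_cases i <;> rfl
  rw [e']

/-- The rescaled Aizenman normalisation `ρ(1/l)⁴·⟨σσ⟩⟨σσ⟩(l·tetra)` converges to `S₂(y_{A,0},y_{A,1})·S₂(y_{A,2},y_{A,3})`.
[folklore] -/
theorem tendsto_rescaled_GGcrit (hlim : HasPointwiseScalingLimit (criticalCorr 3) ρ S) :
    Tendsto (fun l : ℕ => ρ ((l : ℝ)⁻¹) ^ 4 * GGcrit l) atTop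
      (𝓝 (S 2 ![yTetra 0, yTetra 1] * S 2 ![yTetra 2, yTetra 3])) := by
  refine ((tendsto_rescaled_pair hlim (show (0 : Fin 4) ≠ 1 by decide)).mul
    (tendsto_rescaled_pair hlim (show (2 : Fin 4) ≠ 3 by decide))).congr fun l => ?_
  simp only [GGcrit]
  ring

/-- The rescaled lattice Ursell function `ρ(1/l)⁴·U₄crit(l·tetra)` converges to `U₄(S)(y_A)`. [folklore] -/
theorem tendsto_rescaled_U4crit (hlim : HasPointwiseScalingLimit (criticalCorr 3) ρ S) :
    Tendsto (fun l : ℕ => ρ ((l : ℝ)⁻¹) ^ 4 * U4crit l) atTop (𝓝 (limitConnectedFour S yTetra)) := by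
  have h4 := tendsto_rescaled_criticalCorr hlim tetra_inj
  have h := h4.sub ((((tendsto_rescaled_pair hlim (show (0 : Fin 4) ≠ 1 by decide)).mul
      (tendsto_rescaled_pair hlim (show (2 : Fin 4) ≠ 3 by decide))).add
    ((tendsto_rescaled_pair hlim (show (0 : Fin 4) ≠ 2 by decide)).mul
      (tendsto_rescaled_pair hlim (show (1 : Fin 4) ≠ 3 by decide)))).add
    ((tendsto_rescaled_pair hlim (show (0 : Fin 4) ≠ 3 by decide)).mul
      (tendsto_rescaled_pair hlim (show (1 : Fin 4) ≠ 2 by decide))))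
  refine h.congr fun l => ?_
  simp only [U4crit]
  ring

/-- Non-degeneracy: `S₂(y_{A,0},y_{A,1})·S₂(y_{A,2},y_{A,3}) > 0`. [folklore] -/
theorem limit_GG_tetra_pos (hnd : IsNondegenerateTwoPoint S) :
    0 < S 2 ![yTetra 0, yTetra 1] * S 2 ![yTetra 2, yTetra 3] :=
  mul_pos (hnd _ (injective_vecCons_pair (yTetra_injective.ne (by decide))))
    (hnd _ (injective_vecCons_pair (yTetra_injective.ne (by decide))))

/-! ### The four clauses of the registered sub-goal -/

/-- **(a) The shape transfer in the limit**: `S₄(y_A) ≤ S₄(y_R)` — the reflection-positivity inequality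
`⟨σσσσ⟩(l·tetra) ≤ ⟨σσσσ⟩(l·rect)` (`criticalCorr_tetra_le_rect`), rescaled by `ρ(1/l)⁴ ≥ 0`, passes to the limit.
[folklore] -/
theorem limit_S4_tetra_le_rect (hlim : HasPointwiseScalingLimit (criticalCorr 3) ρ S) :
    S 4 yTetra ≤ S 4 (fun i => WithLp.toLp 2 fun k =>
      ((((![![-1, -1, -1], ![1, 1, -1], ![-1, -1, 1], ![1, 1, 1]] : Fin 4 → Site 3) i k : ℤ) : ℝ))) :=
  le_of_tendsto_of_tendsto' (tendsto_rescaled_criticalCorr hlim tetra_inj)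
    (tendsto_rescaled_criticalCorr hlim rect_injective) fun l =>
    mul_le_mul_of_nonneg_left (criticalCorr_tetra_le_rect l) (by positivity)

/-- **(b) The Ursell form in the limit**: `U₄(S)(y_A) ≤ S₄(y_R) − 3·S₂(y_{A,0},y_{A,1})·S₂(y_{A,2},y_{A,3})`
(`U4crit_le_rect` rescaled by `ρ(1/l)⁴ ≥ 0` and passed to the limit). [folklore] -/
theorem limitConnectedFour_tetra_le_rect (hlim : HasPointwiseScalingLimit (criticalCorr 3) ρ S) :
    limitConnectedFour S yTetra ≤ S 4 (fun i => WithLp.toLp 2 fun k =>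
        ((((![![-1, -1, -1], ![1, 1, -1], ![-1, -1, 1], ![1, 1, 1]] : Fin 4 → Site 3) i k : ℤ) : ℝ))) -
      3 * (S 2 ![yTetra 0, yTetra 1] * S 2 ![yTetra 2, yTetra 3]) := by
  refine le_of_tendsto_of_tendsto' (tendsto_rescaled_U4crit hlim)
    ((tendsto_rescaled_criticalCorr hlim rect_injective).sub ((tendsto_rescaled_GGcrit hlim).const_mul 3))
    fun l => ?_
  have h := mul_le_mul_of_nonneg_left (U4crit_le_rect l) (show 0 ≤ ρ ((l : ℝ)⁻¹) ^ 4 by positivity)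
  linarith

/-- **(c) RectDominance ↔ the strict limit inequality `S₄(y_R) < 3·S₂S₂`** (the ratio/limit lemma
`eventually_le_sub_mul_iff_limit_lt` with `r_l = ρ(1/l)⁴ > 0`, `f = ⟨σσσσ⟩(l·rect)`, `g = GG`, `κ = 3`,
`B = S₂S₂ > 0` by non-degeneracy). [folklore] -/
theorem rectDominance_iff_limit (hρ : ∀ δ ∈ Set.Ioc (0:ℝ) 1, 0 < ρ δ)
    (hlim : HasPointwiseScalingLimit (criticalCorr 3) ρ S) (hnd : IsNondegenerateTwoPoint S) :
    (∃ c : ℝ, 0 < c ∧ ∃ l₁ : ℕ, ∀ l : ℕ, l₁ ≤ l →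
        criticalCorr 3 4 (fun i => (l : ℤ) •
          (![![-1, -1, -1], ![1, 1, -1], ![-1, -1, 1], ![1, 1, 1]] : Fin 4 → Site 3) i) ≤ (3 - c) * GGcrit l) ↔
      S 4 (fun i => WithLp.toLp 2 fun k =>
          ((((![![-1, -1, -1], ![1, 1, -1], ![-1, -1, 1], ![1, 1, 1]] : Fin 4 → Site 3) i k : ℤ) : ℝ))) <
        3 * (S 2 ![yTetra 0, yTetra 1] * S 2 ![yTetra 2, yTetra 3]) :=
  eventually_le_sub_mul_iff_limit_lt (fun _ hl => rho_inv_natCast_pow_pos hρ hl 4)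
    (tendsto_rescaled_criticalCorr hlim rect_injective) (tendsto_rescaled_GGcrit hlim) (limit_GG_tetra_pos hnd)

/-- **(d)** The strict limit inequality `S₄(y_R) < 3·S₂S₂` forces `U₄(S)(y_A) < 0` (by (b)), hence the crux by the
landed dictionary `independentStrandsJoin_iff_limitU4_tetra_neg`. [folklore] -/
theorem independentStrandsJoin_of_limit_rect (hρ : ∀ δ ∈ Set.Ioc (0:ℝ) 1, 0 < ρ δ)
    (hlim : HasPointwiseScalingLimit (criticalCorr 3) ρ S) (hnd : IsNondegenerateTwoPoint S)
    (hlt : S 4 (fun i => WithLp.toLp 2 fun k =>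
        ((((![![-1, -1, -1], ![1, 1, -1], ![-1, -1, 1], ![1, 1, 1]] : Fin 4 → Site 3) i k : ℤ) : ℝ))) <
      3 * (S 2 ![yTetra 0, yTetra 1] * S 2 ![yTetra 2, yTetra 3])) :
    IndependentStrandsJoin := by
  refine (independentStrandsJoin_iff_limitU4_tetra_neg hρ hlim hnd).2 ?_
  have h := limitConnectedFour_tetra_le_rect hlim
  linarith

end limit

end Summit.CriticalPhenomena.Ising3DConformalLimit.Cruxes.IndependentStrandsJoin.PinchToTetra

/-! ## The registered sub-goal `stub_rectLimitDictionary` (crux stmt-CriticalPhenomena-14625, line `pinch-to-tetra` r6) -/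

namespace Summit.CriticalPhenomena.Ising3DConformalLimit.Theorems

open Summit.CriticalPhenomena.Ising3DConformalLimit.Cruxes.IndependentStrandsJoin.PinchToTetra

/-- **stub_rectLimitDictionary** (lead c6-0, line `pinch-to-tetra` r6): for every non-degenerate pointwise scaling
limit `(ρ, S)` of `criticalCorr 3`, with `y_A` the regular tetrahedron and `y_R` the RP-diagonal rectangle cast to `ℝ³`:
(a) `S₄(y_A) ≤ S₄(y_R)`; (b) `U₄(S)(y_A) ≤ S₄(y_R) − 3·S₂S₂`; (c) RectDominance `↔ S₄(y_R) < 3·S₂S₂`;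
(d) `S₄(y_R) < 3·S₂S₂ → IndependentStrandsJoin`. -/
theorem stub_rectLimitDictionary : ∀ (ρ : ℝ → ℝ) (S : CorrFamily 3), (∀ δ ∈ Set.Ioc (0:ℝ) 1, 0 < ρ δ) → HasPointwiseScalingLimit (criticalCorr 3) ρ S → IsNondegenerateTwoPoint S → (S 4 yTetra ≤ S 4 (fun i => WithLp.toLp 2 fun k => ((((![![-1, -1, -1], ![1, 1, -1], ![-1, -1, 1], ![1, 1, 1]] : Fin 4 → Site 3) i k : ℤ) : ℝ)))) ∧ (limitConnectedFour S yTetra ≤ S 4 (fun i => WithLp.toLp 2 fun k => ((((![![-1, -1, -1], ![1, 1, -1], ![-1, -1, 1], ![1, 1, 1]] : Fin 4 → Site 3) i k : ℤ) : ℝ))) - 3 * (S 2 ![yTetra 0, yTetra 1] * S 2 ![yTetra 2, yTetra 3])) ∧ ((∃ c : ℝ, 0 < c ∧ ∃ l₁ : ℕ, ∀ l : ℕ, l₁ ≤ l → criticalCorr 3 4 (fun i => (l : ℤ) • (![![-1, -1, -1], ![1, 1, -1], ![-1, -1, 1], ![1, 1, 1]] : Fin 4 → Site 3) i) ≤ (3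 - c) * GGcrit l) ↔ S 4 (fun i => WithLp.toLp 2 fun k => ((((![![-1, -1, -1], ![1, 1, -1], ![-1, -1, 1], ![1, 1, 1]] : Fin 4 → Site 3) i k : ℤ) : ℝ))) < 3 * (S 2 ![yTetra 0, yTetra 1] * S 2 ![yTetra 2, yTetra 3])) ∧ (S 4 (fun i => WithLp.toLp 2 fun k => ((((![![-1, -1, -1], ![1, 1, -1], ![-1, -1, 1], ![1, 1, 1]] : Fin 4 → Site 3) i k : ℤ) : ℝ))) < 3 * (S 2 ![yTetra 0, yTetra 1] * S 2 ![yTetra 2, yTetra 3]) → IndependentStrandsJoin) :=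
  fun _ _ hρ hlim hnd =>
    ⟨limit_S4_tetra_le_rect hlim, limitConnectedFour_tetra_le_rect hlim, rectDominance_iff_limit hρ hlim hnd,
      independentStrandsJoin_of_limit_rect hρ hlim hnd⟩

end Summit.CriticalPhenomena.Ising3DConformalLimit.Theorems

end
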